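import Literature.Barriers.CriticalPhenomena.LaceExpansionKernelTaylor
import Mathlib.Analysis.Calculus.SmoothSeries
import HarnessLib

/-!
# Derivatives of the lattice Fourier transform of Hara's kernel (Hara 2008, Lemma 2.1 (2.10))

Barrier catalogue `Literature/Barriers/CriticalPhenomena/` (D-0021), infrastructure for the last
analytic named fact `Hara2008_lem23` (Hara 2008, Lemma 2.3: decay of `I_t(x)` by `d` integrations
by parts in `k`) behind `Hara2008_thm13` and `Hara2008_etaZeroXSpace`. All PROVED:

* the derivative series `latticeFTD1 J j k = ∂_jĴ(k) = Σ_x (-ix_j)J(x)e^{-ik·x}` and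
  `latticeFTD2 J j l k = ∂_l∂_jĴ(k) = Σ_x (-x_jx_l)J(x)e^{-ik·x}`, their absolute convergence,
  continuity and the bounds `|∂_jĴ| ≤ Σ|x_j||J|`, `|∂_l∂_jĴ| ≤ Σ|x|²|J| = K₂` ((2.10));
* `hasDerivAt_latticeFT`, `hasDerivAt_latticeFTD1` — they ARE the coordinate derivatives
  (termwise differentiation, Mathlib's `hasDerivAt_tsum`, under `Σ(1+|x|²)|J| < ∞`);
* `2π`-periodicity of `Ĵ`, `∂_jĴ` in each coordinate (`x ∈ ℤ^d`);
* for an even kernel: `∂_jĴ(k) = -Σ_x x_jJ(x)sin(k·x)` and the isotropic first-derivative bound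
  `|∂_jĴ(k)| ≤ K₂|k|` (`norm_latticeFTD1_le_mul_knorm`; Hara's `(K₂/d)|k_j|` uses the full
  `ℤ^d`-symmetry and is not needed).

## References

* T. Hara, Ann. Probab. 36 (2008) 530–593 (arXiv:math-ph/0504021): Lemma 2.1 (2.10) and its
  proof ((2.35)–(2.36)); Lemma 2.3 (where these enter: (2.37)–(2.38)).
-/

noncomputable section

namespace Literature.Barriers.CriticalPhenomena

open MeasureTheory Filter Finset Literature.Probability.LatticeModels Literature.Probability.Percolation
open scoped Topology BigOperators

variable {d : ℕ}

/-! ### The derivative series -/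

/-- The first-derivative series `∂_j Ĵ(k) = Σ_x (-i x_j) J(x) e^{-ik·x}`.
[cite: Hara2008, Lemma 2.1 (2.10) and its proof ((2.35))] -/
def latticeFTD1 (J : Site d → ℝ) (j : Fin d) (k : Fin d → ℝ) : ℂ :=
  ∑' x : Site d, (-(Complex.I * ((x j : ℤ) : ℂ))) * ((J x : ℂ) * Complex.exp (-(Complex.I * (kdot k x : ℂ))))

/-- The second-derivative series `∂_l ∂_j Ĵ(k) = Σ_x (-x_j x_l) J(x) e^{-ik·x}`.
[cite: Hara2008, Lemma 2.1 (2.10) and its proof ((2.36))] -/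
def latticeFTD2 (J : Site d → ℝ) (j l : Fin d) (k : Fin d → ℝ) : ℂ :=
  ∑' x : Site d, (-(((x j : ℤ) : ℂ) * ((x l : ℤ) : ℂ))) * ((J x : ℂ) * Complex.exp (-(Complex.I * (kdot k x : ℂ))))

/-- The moment `Σ_x |x_j| |J(x)|` is finite when `Σ_x (1 + |x|²)|J(x)| < ∞`. [folklore] -/
theorem summable_abs_apply_mul_abs {J : Site d → ℝ} (h0 : Summable fun x => |J x|)
    (h2 : Summable fun x => euclidNorm x ^ 2 * |J x|) (j : Fin d) :
    Summable fun x => |((x j : ℤ) : ℝ)| * |J x| := by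
  refine Summable.of_nonneg_of_le (fun x => by positivity) (fun x => ?_) (h0.add h2)
  have h := abs_apply_le_euclidNorm x j
  have : |((x j : ℤ) : ℝ)| ≤ 1 + euclidNorm x ^ 2 := by nlinarith [euclidNorm_nonneg x]
  nlinarith [abs_nonneg (J x)]

/-- The terms of `∂_j Ĵ` have norm `|x_j| |J(x)|`. [folklore] -/
theorem norm_latticeFTD1_term (J : Site d → ℝ) (j : Fin d) (k : Fin d → ℝ) (x : Site d) :
    ‖(-(Complex.I * ((x j : ℤ) : ℂ))) * ((J x : ℂ) * Complex.exp (-(Complex.I * (kdot k x : ℂ))))‖ =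
      |((x j : ℤ) : ℝ)| * |J x| := by
  rw [norm_mul, norm_neg, norm_mul, Complex.norm_I, one_mul, norm_mul, Complex.norm_real, Complex.norm_exp,
    Complex.norm_intCast, Real.norm_eq_abs]
  simp

/-- The terms of `∂_l∂_j Ĵ` have norm `|x_j x_l| |J(x)| ≤ |x|² |J(x)|`. [folklore] -/
theorem norm_latticeFTD2_term_le (J : Site d → ℝ) (j l : Fin d) (k : Fin d → ℝ) (x : Site d) :
    ‖(-(((x j : ℤ) : ℂ) * ((x l : ℤ) : ℂ))) * ((J x : ℂ) * Complex.exp (-(Complex.I * (kdot k x : ℂ))))‖ ≤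
      euclidNorm x ^ 2 * |J x| := by
  rw [norm_mul, norm_neg, norm_mul, norm_mul, Complex.norm_real, Complex.norm_exp, Complex.norm_intCast,
    Complex.norm_intCast, Real.norm_eq_abs]
  simp only [Complex.neg_re, Complex.mul_re, Complex.I_re, Complex.ofReal_re, zero_mul, Complex.I_im,
    Complex.ofReal_im, mul_zero, sub_zero, neg_zero, Real.exp_zero, mul_one]
  have h := abs_apply_mul_apply_le x j l
  rw [abs_mul] at h
  exact mul_le_mul_of_nonneg_right h (abs_nonneg _)

/-- `|∂_j Ĵ(k)| ≤ Σ_x |x_j||J(x)|` and the series converges absolutely. [folklore] -/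
theorem norm_latticeFTD1_le {J : Site d → ℝ} (h0 : Summable fun x => |J x|)
    (h2 : Summable fun x => euclidNorm x ^ 2 * |J x|) (j : Fin d) (k : Fin d → ℝ) :
    ‖latticeFTD1 J j k‖ ≤ ∑' x, |((x j : ℤ) : ℝ)| * |J x| := by
  unfold latticeFTD1
  exact tsum_of_norm_bounded (summable_abs_apply_mul_abs h0 h2 j).hasSum
    fun x => le_of_eq (norm_latticeFTD1_term J j k x)

/-- **(2.10), second derivatives**: `|∂_l∂_j Ĵ(k)| ≤ Σ_x |x|²|J(x)| = K₂`. [cite: Hara2008, Lemma 2.1 (2.10)] -/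
theorem norm_latticeFTD2_le {J : Site d → ℝ} (h2 : Summable fun x => euclidNorm x ^ 2 * |J x|)
    (j l : Fin d) (k : Fin d → ℝ) :
    ‖latticeFTD2 J j l k‖ ≤ ∑' x, euclidNorm x ^ 2 * |J x| := by
  unfold latticeFTD2
  exact tsum_of_norm_bounded h2.hasSum fun x => norm_latticeFTD2_term_le J j l k x

/-- `∂_j Ĵ` is continuous. [folklore] -/
theorem continuous_latticeFTD1 {J : Site d → ℝ} (h0 : Summable fun x => |J x|)
    (h2 : Summable fun x => euclidNorm x ^ 2 * |J x|) (j : Fin d) : Continuous (latticeFTD1 J j) := by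
  unfold latticeFTD1
  refine continuous_tsum (fun x => ?_) (summable_abs_apply_mul_abs h0 h2 j)
    fun x k => le_of_eq (norm_latticeFTD1_term J j k x)
  exact continuous_const.mul (continuous_const.mul (Complex.continuous_exp.comp
    ((continuous_const.mul (Complex.continuous_ofReal.comp (continuous_kdot' x))).neg)))
where
  /-- continuity of `k ↦ k·x` -/
  continuous_kdot' (x : Site d) : Continuous fun k : Fin d → ℝ => kdot k x := by unfold kdot; fun_prop

/-- `∂_l∂_j Ĵ` is continuous. [folklore] -/
theorem continuous_latticeFTD2 {J : Site d → ℝ} (h2 : Summable fun x => euclidNorm x ^ 2 * |J x|)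
    (j l : Fin d) : Continuous (latticeFTD2 J j l) := by
  unfold latticeFTD2
  refine continuous_tsum (fun x => ?_) h2 fun x k => norm_latticeFTD2_term_le J j l k x
  have hk : Continuous fun k : Fin d → ℝ => kdot k x := by unfold kdot; fun_prop
  exact continuous_const.mul (continuous_const.mul (Complex.continuous_exp.comp
    ((continuous_const.mul (Complex.continuous_ofReal.comp hk)).neg)))

/-! ### Differentiability in one coordinate -/

/-- `k·x` after updating one coordinate: `(k[l ↦ s])·x = k·x + (s - k_l) x_l`. [folklore] -/
theorem kdot_update (k : Fin d → ℝ) (l : Fin d) (s : ℝ) (x : Site d) :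
    kdot (Function.update k l s) x = kdot k x + (s - k l) * ((x l : ℤ) : ℝ) := by
  classical
  unfold kdot
  rw [← Finset.add_sum_erase _ _ (Finset.mem_univ l), ← Finset.add_sum_erase _ (fun j => k j * (x j : ℝ)) (Finset.mem_univ l)]
  simp only [Function.update_self]
  rw [Finset.sum_congr rfl fun j hj => by rw [Function.update_of_ne (Finset.ne_of_mem_erase hj)]]
  ring

/-- The terms of `Ĵ` are differentiable in `k_l` with derivative the terms of `∂_l Ĵ`. [folklore] -/
theorem hasDerivAt_latticeFT_term (J : Site d → ℝ) (k : Fin d → ℝ) (l : Fin d) (x : Site d) (s : ℝ) :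
    HasDerivAt (fun s : ℝ => (J x : ℂ) * Complex.exp (-(Complex.I * (kdot (Function.update k l s) x : ℂ))))
      ((-(Complex.I * ((x l : ℤ) : ℂ))) * ((J x : ℂ) *
        Complex.exp (-(Complex.I * (kdot (Function.update k l s) x : ℂ))))) s := by
  have h1 : HasDerivAt (fun s : ℝ => kdot (Function.update k l s) x) ((x l : ℤ) : ℝ) s := by
    simp_rw [kdot_update]
    have := ((hasDerivAt_id s).sub_const (k l)).mul_const (((x l : ℤ) : ℝ))
    simpa using this.const_add (kdot k x)
  have hlin : HasDerivAt (fun s : ℝ => -Complex.I * (kdot (Function.update k l s) x : ℂ))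
      (-Complex.I * ((x l : ℤ) : ℂ)) s := by
    have h2 := (h1.ofReal_comp).const_mul (-Complex.I)
    simpa using h2
  have h := (hlin.cexp).const_mul (J x : ℂ)
  have hfun : (fun s : ℝ => (J x : ℂ) * Complex.exp (-(Complex.I * (kdot (Function.update k l s) x : ℂ)))) =
      fun s : ℝ => (J x : ℂ) * Complex.exp (-Complex.I * (kdot (Function.update k l s) x : ℂ)) := by
    funext s; ring_nf
  rw [hfun]
  refine h.congr_deriv ?_
  rw [show -(Complex.I * (kdot (Function.update k l s) x : ℂ)) = -Complex.I * (kdot (Function.update k l s) x : ℂ)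
    by ring]
  ring

/-- **`∂_l Ĵ` is the derivative of `Ĵ` in the coordinate `k_l`** (termwise differentiation of an
absolutely convergent trigonometric series with `Σ_x |x_l||J(x)| < ∞`). [cite: Hara2008, proof of Lemma 2.1 ((2.35))] -/
theorem hasDerivAt_latticeFT {J : Site d → ℝ} (h0 : Summable fun x => |J x|)
    (h2 : Summable fun x => euclidNorm x ^ 2 * |J x|) (k : Fin d → ℝ) (l : Fin d) (s : ℝ) :
    HasDerivAt (fun s : ℝ => latticeFT J (Function.update k l s)) (latticeFTD1 J l (Function.update k l s)) s := by
  unfold latticeFT latticeFTD1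
  refine hasDerivAt_tsum (summable_abs_apply_mul_abs h0 h2 l) (fun x y => hasDerivAt_latticeFT_term J k l x y)
    (fun x y => le_of_eq (norm_latticeFTD1_term J l _ x)) (y₀ := s) ?_ s
  exact summable_latticeFT_term h0 _

/-- The terms of `∂_j Ĵ` are differentiable in `k_l` with derivative the terms of `∂_l∂_j Ĵ`. [folklore] -/
theorem hasDerivAt_latticeFTD1_term (J : Site d → ℝ) (j : Fin d) (k : Fin d → ℝ) (l : Fin d) (x : Site d) (s : ℝ) :
    HasDerivAt (fun s : ℝ => (-(Complex.I * ((x j : ℤ) : ℂ))) * ((J x : ℂ) *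
        Complex.exp (-(Complex.I * (kdot (Function.update k l s) x : ℂ)))))
      ((-(((x j : ℤ) : ℂ) * ((x l : ℤ) : ℂ))) * ((J x : ℂ) *
        Complex.exp (-(Complex.I * (kdot (Function.update k l s) x : ℂ))))) s := by
  refine ((hasDerivAt_latticeFT_term J k l x s).const_mul (-(Complex.I * ((x j : ℤ) : ℂ)))).congr_deriv ?_
  have hI : Complex.I * Complex.I = -1 := Complex.I_mul_I
  linear_combination (((x j : ℤ) : ℂ) * ((x l : ℤ) : ℂ) * ((J x : ℂ) *
    Complex.exp (-(Complex.I * (kdot (Function.update k l s) x : ℂ))))) * hI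

/-- **`∂_l∂_j Ĵ` is the derivative of `∂_j Ĵ` in the coordinate `k_l`** (`Σ_x |x|²|J(x)| < ∞`).
[cite: Hara2008, proof of Lemma 2.1 ((2.36))] -/
theorem hasDerivAt_latticeFTD1 {J : Site d → ℝ} (h0 : Summable fun x => |J x|)
    (h2 : Summable fun x => euclidNorm x ^ 2 * |J x|) (j : Fin d) (k : Fin d → ℝ) (l : Fin d) (s : ℝ) :
    HasDerivAt (fun s : ℝ => latticeFTD1 J j (Function.update k l s))
      (latticeFTD2 J j l (Function.update k l s)) s := by
  unfold latticeFTD1 latticeFTD2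
  refine hasDerivAt_tsum h2 (fun x y => hasDerivAt_latticeFTD1_term J j k l x y)
    (fun x y => norm_latticeFTD2_term_le J j l _ x) (y₀ := s) ?_ s
  exact (summable_abs_apply_mul_abs h0 h2 j).of_norm_bounded fun x => le_of_eq (norm_latticeFTD1_term J j _ x)

/-! ### Periodicity in each coordinate -/

/-- `e^{-i(k + 2π e_l)·x} = e^{-ik·x}` for `x ∈ ℤ^d`. [folklore] -/
theorem cexp_neg_I_kdot_update_add_two_pi (k : Fin d → ℝ) (l : Fin d) (s : ℝ) (x : Site d) :
    Complex.exp (-(Complex.I * (kdot (Function.update k l (s + 2 * Real.pi)) x : ℂ))) =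
      Complex.exp (-(Complex.I * (kdot (Function.update k l s) x : ℂ))) := by
  rw [kdot_update, kdot_update]
  have h : -(Complex.I * ((kdot k x + (s + 2 * Real.pi - k l) * ((x l : ℤ) : ℝ) : ℝ) : ℂ)) =
      -(Complex.I * ((kdot k x + (s - k l) * ((x l : ℤ) : ℝ) : ℝ) : ℂ)) + (-(x l : ℤ) : ℂ) * (2 * Real.pi * Complex.I) := by
    push_cast; ring
  rw [h, Complex.exp_add, show (-(x l : ℤ) : ℂ) = ((-x l : ℤ) : ℂ) by push_cast; ring,
    Complex.exp_int_mul_two_pi_mul_I, mul_one]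

/-- `Ĵ` is `2π`-periodic in each coordinate. [folklore] -/
theorem latticeFT_update_add_two_pi (J : Site d → ℝ) (k : Fin d → ℝ) (l : Fin d) (s : ℝ) :
    latticeFT J (Function.update k l (s + 2 * Real.pi)) = latticeFT J (Function.update k l s) := by
  unfold latticeFT
  exact tsum_congr fun x => by rw [cexp_neg_I_kdot_update_add_two_pi]

/-- `∂_j Ĵ` is `2π`-periodic in each coordinate. [folklore] -/
theorem latticeFTD1_update_add_two_pi (J : Site d → ℝ) (j : Fin d) (k : Fin d → ℝ) (l : Fin d) (s : ℝ) :
    latticeFTD1 J j (Function.update k l (s + 2 * Real.pi)) = latticeFTD1 J j (Function.update k l s) := by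
  unfold latticeFTD1
  exact tsum_congr fun x => by rw [cexp_neg_I_kdot_update_add_two_pi]

/-! ### Evenness: `∂_j Ĵ(k) = -Σ_x x_j sin(k·x) J(x)` and the bound `|∂_j Ĵ(k)| ≤ K₂ |k|` -/

/-- For an even kernel, `∂_j Ĵ(k) = -Σ_x x_j J(x) sin(k·x)` (pair `x` with `-x`). [cite: Hara2008, proof of Lemma 2.1 ((2.35))] -/
theorem latticeFTD1_eq_of_even {J : Site d → ℝ} (h0 : Summable fun x => |J x|)
    (h2 : Summable fun x => euclidNorm x ^ 2 * |J x|) (hJe : ∀ x, J (-x) = J x) (j : Fin d) (k : Fin d → ℝ) :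
    latticeFTD1 J j k = -((∑' x, ((x j : ℤ) : ℝ) * J x * Real.sin (kdot k x) : ℝ) : ℂ) := by
  have hs := (summable_abs_apply_mul_abs h0 h2 j).of_norm_bounded fun x => le_of_eq (norm_latticeFTD1_term J j k x)
  set g : Site d → ℂ := fun x => (-(Complex.I * ((x j : ℤ) : ℂ))) * ((J x : ℂ) * Complex.exp (-(Complex.I * (kdot k x : ℂ)))) with hg
  have hs2 : Summable fun x => g (-x) := (Equiv.neg (Site d)).summable_iff.2 hs
  have hneg : ∑' x, g x = ∑' x, g (-x) := ((Equiv.neg (Site d)).tsum_eq g).symm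
  have h2g : 2 * latticeFTD1 J j k = ∑' x, (g x + g (-x)) := by
    rw [Summable.tsum_add hs hs2, ← hneg, ← two_mul]
    rfl
  set r : Site d → ℝ := fun x => ((x j : ℤ) : ℝ) * J x * Real.sin (kdot k x) with hr
  have hpair : ∀ x, g x + g (-x) = 2 * (-((r x : ℝ) : ℂ)) := by
    intro x
    simp only [hg, hr, Pi.neg_apply, Int.cast_neg, hJe, kdot_neg]
    push_cast
    rw [show -(Complex.I * -(kdot k x : ℂ)) = (kdot k x : ℂ) * Complex.I by ring,
      show -(Complex.I * (kdot k x : ℂ)) = -(kdot k x : ℂ) * Complex.I by ring]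
    rw [Complex.exp_mul_I, Complex.exp_mul_I]
    simp only [Complex.cos_neg, Complex.sin_neg, ← Complex.ofReal_sin, ← Complex.ofReal_cos]
    have hI : Complex.I * Complex.I = -1 := Complex.I_mul_I
    linear_combination (2 * ((x j : ℤ) : ℂ) * (J x : ℂ) * (Real.sin (kdot k x) : ℂ)) * hI
  have h3 : latticeFTD1 J j k = ∑' x, -((r x : ℝ) : ℂ) :=
    mul_left_cancel₀ (two_ne_zero : (2 : ℂ) ≠ 0) (by rw [h2g, tsum_congr hpair, tsum_mul_left])
  rw [h3, tsum_neg, ← Complex.ofReal_tsum]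


/-- **(2.10), first derivatives, in the isotropic form `|∂_j Ĵ(k)| ≤ K₂ |k|`** for an even kernel:
`|Σ_x x_j J(x) sin(k·x)| ≤ Σ_x |x_j||J(x)||k·x| ≤ |k| Σ_x |x|²|J(x)|` (Hara's sharper
`(K₂/d)|k_j|` uses the full `ℤ^d`-symmetry; this form suffices downstream).
[cite: Hara2008, Lemma 2.1 (2.10) and its proof ((2.35))] -/
theorem norm_latticeFTD1_le_mul_knorm {J : Site d → ℝ} (h0 : Summable fun x => |J x|)
    (h2 : Summable fun x => euclidNorm x ^ 2 * |J x|) (hJe : ∀ x, J (-x) = J x) (j : Fin d) (k : Fin d → ℝ) :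
    ‖latticeFTD1 J j k‖ ≤ (∑' x, euclidNorm x ^ 2 * |J x|) * knorm k := by
  rw [latticeFTD1_eq_of_even h0 h2 hJe j k, norm_neg, Complex.norm_real, Real.norm_eq_abs]
  have hpt : ∀ x : Site d, ‖((x j : ℤ) : ℝ) * J x * Real.sin (kdot k x)‖ ≤ knorm k * (euclidNorm x ^ 2 * |J x|) := by
    intro x
    rw [Real.norm_eq_abs, abs_mul, abs_mul]
    have h1 : |Real.sin (kdot k x)| ≤ |kdot k x| := Real.abs_sin_le_abs
    have h2' : |kdot k x| ≤ knorm k * euclidNorm x := abs_kdot_le k x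
    have h3 : |((x j : ℤ) : ℝ)| ≤ euclidNorm x := abs_apply_le_euclidNorm x j
    have hk0 := knorm_nonneg k
    have he0 := euclidNorm_nonneg x
    calc |((x j : ℤ) : ℝ)| * |J x| * |Real.sin (kdot k x)| ≤ euclidNorm x * |J x| * (knorm k * euclidNorm x) := by
          gcongr; exact h1.trans h2'
      _ = knorm k * (euclidNorm x ^ 2 * |J x|) := by ring
  refine (Real.norm_eq_abs _ ▸ tsum_of_norm_bounded (h2.mul_left (knorm k)).hasSum hpt).trans (le_of_eq ?_)
  rw [tsum_mul_left, mul_comm]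

end Literature.Barriers.CriticalPhenomena
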